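import Literature.AlgebraicGeometry.HodgeTheory.CyclicCoverTotalSpacePoints
import HarnessLib

/-!
# Homogeneous coordinates on the total space of the universal family of smooth hypersurfaces:
# `𝒴_U(ℂ) ≅ {([z], s) | F_s(z) = 0}` on points

Family `hodge`, layer `Literature/AlgebraicGeometry/Motives`; theorems only (no definition, no named fact).
The general-`(n, d)` form, for the universal family `π : 𝒴_U → U` itself (`UniversalHypersurface.family ℂ n d`),
of `HodgeTheory/CyclicCoverTotalSpacePoints` (which treats its pull-back, the Carlson–Toledo family of cyclic
covers): with `[z] : 𝒴_U(ℂ) → ℙ(ℂⁿ⁺²)` the homogeneous-coordinate map of the projection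
`toProjectiveSpace : 𝒴_U → ℙⁿ⁺¹` (`HodgeTheory.hypersurfacePoint`),

* `hypersurfacePoint_map_fiberι_family` — the coordinates of a point of the fibre `𝒴_s` are those of the
  corresponding point of the model hypersurface `X_{F_s}` (through `exists_fiberIso_comp_hypersurfaceι`);
* `hypersurfacePoint_mem_projZeroLocus_pointForm` — **every point of `𝒴_U(ℂ)` lies on the hypersurface of its
  base point**: `F_{π(P)}(z(P)) = 0`;
* `eq_of_hypersurfacePoint_eq_of_map_family_eq` — **`([z], π)` is injective on `𝒴_U(ℂ)`**;
* `exists_point_of_mem_projZeroLocus_pointForm` — **every projective zero of `F_s` is `[z](P)` for a point `P`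
  over `s`**.

Written by the prover seat `hodge-nonav-prover-Ax` (g10) for the programme discharging the nodal-meridian local
monodromy fact (`HodgeTheory/CyclicCoverNodalMeridianLocalMonodromyBound`): these identify the fibres `π⁻¹(s)` of the
complex manifold `𝒴°(ℂ) ⊇ 𝒴_U(ℂ)` with the projective surfaces `{F_s = 0}` in the regular coordinates of
`UniversalHypersurfaceRegularLocusCoordinates`.

## References

* [VoisinHodgeII2003] C. Voisin, Hodge Theory and Complex Algebraic Geometry II (2003), §6.2.1 (the universal
  hypersurface `{(x, F) | F(x) = 0}`).
* [SerreGAGA1956] J.-P. Serre, Géométrie algébrique et géométrie analytique, Ann. Inst. Fourier 6 (1956), §2 n°5.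
-/

noncomputable section

namespace Literature.AlgebraicGeometry.Motives.UniversalHypersurface

open CategoryTheory _root_.AlgebraicGeometry _root_.Topology
open scoped LinearAlgebra.Projectivization
open Literature.AlgebraicGeometry.HodgeTheory Literature.AlgebraicGeometry.HodgeTheory.UniversalHypersurface

variable (n d : ℕ)

/-- **The coordinates of a point of the fibre are those of the corresponding point of the model**: for an
identification `e : 𝒴_s ≅ X_G` compatible with the embeddings into `ℙⁿ⁺¹` and `Q ∈ 𝒴_s(ℂ)`, `[z](ι_s Q) = [z]_{X_G}(e Q)`.
[cite: VoisinHodgeII2003, §6.2.1] [cite: SerreGAGA1956, §2 n°5] -/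
theorem hypersurfacePoint_map_fiberι_family {s : ComplexPoints (base ℂ n d)} {G : MvPolynomial (Fin (n + 2)) ℂ}
    (e : fiberOver (family ℂ n d) s ≅ SmoothHypersurface.hypersurface G)
    (he : e.hom ≫ SmoothHypersurface.hypersurfaceι G = fiberι (family ℂ n d) s ≫ toProjectiveSpace ℂ n d)
    (Q : ComplexPoints (fiberOver (family ℂ n d) s)) :
    hypersurfacePoint (toProjectiveSpace ℂ n d) (AlgPoints.map (fiberι (family ℂ n d) s) Q) =
      hypersurfacePoint (SmoothHypersurface.hypersurfaceι G) (AlgPoints.map e.hom Q) := by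
  rw [← hypersurfacePoint_comp, ← hypersurfacePoint_comp, he]

/-- **Every point of `𝒴_U(ℂ)` lies on the hypersurface of its base point**: the homogeneous coordinates of `P` are a
projective zero of `F_{π(P)}` (`d ≥ 1`). [cite: VoisinHodgeII2003, §6.2.1] -/
theorem hypersurfacePoint_mem_projZeroLocus_pointForm (hd : 0 < d) (P : ComplexPoints (total ℂ n d)) :
    hypersurfacePoint (toProjectiveSpace ℂ n d) P ∈
      Projectivization.projZeroLocus {pointForm ℂ n d (AlgPoints.map (family ℂ n d) P)} := by
  generalize hs : AlgPoints.map (family ℂ n d) P = s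
  obtain ⟨Q, rfl⟩ : P ∈ Set.range (AlgPoints.map (fiberι (family ℂ n d) s)) := by
    rw [AlgPoints.range_map_fiberι]; exact hs
  obtain ⟨e, he⟩ := exists_fiberIso_comp_hypersurfaceι ℂ n d hd s
  have hmem := hypersurfacePoint_mem_projZeroLocus
    (ι := SmoothHypersurface.hypersurfaceι (pointForm ℂ n d s))
    (isHomogeneous_pointForm ℂ n d _) (SmoothHypersurface.range_hypersurfaceι _) (AlgPoints.map e.hom Q)
  rw [hypersurfacePoint_map_fiberι_family n d e he]
  exact hmem

/-- The same in coordinates: `F_{π(P)}(z) = 0` for the representative `z` of `[z](P)` (`d ≥ 1`).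
[cite: VoisinHodgeII2003, §6.2.1] -/
theorem eval_rep_pointForm_eq_zero (hd : 0 < d) (P : ComplexPoints (total ℂ n d)) :
    MvPolynomial.eval (hypersurfacePoint (toProjectiveSpace ℂ n d) P).rep
      (pointForm ℂ n d (AlgPoints.map (family ℂ n d) P)) = 0 := by
  have h := hypersurfacePoint_mem_projZeroLocus_pointForm n d hd P
  rw [← Projectivization.mk_rep (hypersurfacePoint _ P),
    Projectivization.mem_projZeroLocus_mk_iff (by
      rintro G rfl
      by_cases h0 : pointForm ℂ n d (AlgPoints.map (family ℂ n d) P) = 0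
      · rw [h0]; exact MvPolynomial.isHomogeneous_zero _ _ _
      · rw [(isHomogeneous_pointForm ℂ n d _).totalDegree h0]
        exact isHomogeneous_pointForm ℂ n d _)] at h
  simpa using h

/-- **`([z], π)` is injective on `𝒴_U(ℂ)`**: two points over the same `s` with the same homogeneous coordinates
are equal (both come from the fibre `𝒴_s ≅ X_{F_s} ↪ ℙⁿ⁺¹`, and `X_{F_s}(ℂ) → ℙ(ℂⁿ⁺²)` is injective; `d ≥ 1`).
[cite: VoisinHodgeII2003, §6.2.1] [cite: SerreGAGA1956, §2 n°5 Lemme 1 b)] -/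
theorem eq_of_hypersurfacePoint_eq_of_map_family_eq (hd : 0 < d) {P P' : ComplexPoints (total ℂ n d)}
    (hc : hypersurfacePoint (toProjectiveSpace ℂ n d) P = hypersurfacePoint (toProjectiveSpace ℂ n d) P')
    (hs : AlgPoints.map (family ℂ n d) P = AlgPoints.map (family ℂ n d) P') : P = P' := by
  generalize hs' : AlgPoints.map (family ℂ n d) P = s at hs
  obtain ⟨Q, rfl⟩ : P ∈ Set.range (AlgPoints.map (fiberι (family ℂ n d) s)) := by
    rw [AlgPoints.range_map_fiberι]; exact hs'
  obtain ⟨Q', rfl⟩ : P' ∈ Set.range (AlgPoints.map (fiberι (family ℂ n d) s)) := by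
    rw [AlgPoints.range_map_fiberι]; exact hs.symm
  obtain ⟨e, he⟩ := exists_fiberIso_comp_hypersurfaceι ℂ n d hd s
  rw [hypersurfacePoint_map_fiberι_family n d e he, hypersurfacePoint_map_fiberι_family n d e he] at hc
  have hinj := (isEmbedding_hypersurfacePoint (SmoothHypersurface.hypersurfaceι (pointForm ℂ n d s))).injective hc
  have hQ : Q = Q' := by
    have h := congrArg (AlgPoints.map e.inv) hinj
    rw [← AlgPoints.map_comp_apply, ← AlgPoints.map_comp_apply, Iso.hom_inv_id, AlgPoints.map_id] at h
    exact h
  rw [hQ]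

/-- **Every projective zero of `F_s` is the coordinate vector of a point of `𝒴_U(ℂ)` over `s`** (`d ≥ 1`): Voisin's
`𝒴 = {(x, F) | F(x) = 0}` on complex points. [cite: VoisinHodgeII2003, §6.2.1] [cite: SerreGAGA1956, §2 n°5] -/
theorem exists_point_of_mem_projZeroLocus_pointForm (hd : 0 < d) (s : ComplexPoints (base ℂ n d))
    {ℓ : ℙ ℂ (Fin (n + 2) → ℂ)} (hℓ : ℓ ∈ Projectivization.projZeroLocus {pointForm ℂ n d s}) :
    ∃ P : ComplexPoints (total ℂ n d), AlgPoints.map (family ℂ n d) P = s ∧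
      hypersurfacePoint (toProjectiveSpace ℂ n d) P = ℓ := by
  obtain ⟨e, he⟩ := exists_fiberIso_comp_hypersurfaceι ℂ n d hd s
  obtain ⟨Q', hQ'⟩ := exists_hypersurfacePoint_eq (ι := SmoothHypersurface.hypersurfaceι _)
    (isHomogeneous_pointForm ℂ n d _) (SmoothHypersurface.range_hypersurfaceι _) hℓ
  refine ⟨AlgPoints.map (fiberι (family ℂ n d) s) (AlgPoints.map e.inv Q'), AlgPoints.map_map_fiberι _ _ _, ?_⟩
  rw [hypersurfacePoint_map_fiberι_family n d e he, ← AlgPoints.map_comp_apply, Iso.inv_hom_id, AlgPoints.map_id]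
  exact hQ'

/-- The points of `𝒴_U(ℂ)` over `s` are in bijection, by `[z]`, with the projective zeros of `F_s` (`d ≥ 1`).
[cite: VoisinHodgeII2003, §6.2.1] -/
theorem bijOn_hypersurfacePoint_fiber (hd : 0 < d) (s : ComplexPoints (base ℂ n d)) :
    Set.BijOn (hypersurfacePoint (toProjectiveSpace ℂ n d)) (AlgPoints.map (family ℂ n d) ⁻¹' {s})
      (Projectivization.projZeroLocus {pointForm ℂ n d s}) := by
  refine ⟨fun P hP => ?_, fun P hP P' hP' h => ?_, fun ℓ hℓ => ?_⟩
  · have h := hypersurfacePoint_mem_projZeroLocus_pointForm n d hd P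
    rw [Set.mem_preimage, Set.mem_singleton_iff] at hP
    rwa [hP] at h
  · exact eq_of_hypersurfacePoint_eq_of_map_family_eq n d hd h (hP.trans hP'.symm)
  · obtain ⟨P, hP, hPℓ⟩ := exists_point_of_mem_projZeroLocus_pointForm n d hd s hℓ
    exact ⟨P, hP, hPℓ⟩

end Literature.AlgebraicGeometry.Motives.UniversalHypersurface

end
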